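import Summits.Ventures.PercRepro.RankLevelSetRuleQStaircaseTen
import Summits.Ventures.PercRepro.RankLevelSetRuleQSliceFiveWitness
import Summits.Ventures.PercRepro.RankLevelSetRuleQSliceThreeWitnessEight
import Summits.Ventures.PercRepro.RankLevelSetRuleQSliceThreeWitnessNine
import Summits.Ventures.PercRepro.RankLevelSetRuleQSliceFourWitnessNine
import Summits.Ventures.PercRepro.RankLevelSetRuleQSliceFiveWitnessNine
import Summits.Ventures.PercRepro.RankLevelSetRuleQSliceSixWitnessNine
import Summits.Ventures.PercRepro.RankLevelSetRuleQNoFiveUpModel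

/-!
# PercRepro — THE EXACT THIN-SLICE MAPS OF THE FAMILIES `k = 8, 9` UP TO `u = 10`, AND THE UNIFORM STATEMENT FOR `k = 5 … 9`
(night-1, gen 18 → 19; dossier §29.8, §30.8)

With the staircase up to `u = 10` (`rhat_staircase_ten`), the borderline slices (`rhat_eight_slice_six_all`,
`rhat_nine_slice_seven_all`), the ends (`rhatCell_self` / `rhatCell_pred`) and the kernel negatives — the slice `u = 2` for
every `k ≥ 5` (`rhat_lt_phiK_of_five_le`), p4's witnesses `rhat_lt_phiK_126_8_122` (`u = 4` at `k = 8`) and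
`rhat_lt_phiK_408_8_403` (`u = 5` at `k = 8`), and the night-1 witnesses `rhat_lt_phiK_129_8_126` (`u = 3` at `k = 8`),
`rhat_lt_phiK_144_9_141`, `rhat_lt_phiK_93_9_89`, `rhat_lt_phiK_151_9_146`, `rhat_lt_phiK_541_9_535` (`u = 3, 4, 5, 6` at
`k = 9`) — the thin-slice maps are EXACT:
* **`rhat_eight_slice_iff`** — a slice `u ≤ 10` of the family `k = 8` is paid on every cell `(q+8, q)` iff `u ∉ {2, 3, 4, 5}`;
* **`rhat_nine_slice_iff`** — a slice `u ≤ 10` of the family `k = 9` is paid on every cell `(q+9, q)` iff `u ∉ {2, 3, 4, 5, 6}`;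
* **`rhat_thin_slice_iff_nine`** — UNIFORMLY: for `5 ≤ k ≤ 9` and `u ≤ 10`, the slice `u = q − #P` is paid by Rule Q's equal
  split on EVERY cell `(q+k, q)` iff `u ∉ [2, k − 3]`.
The family `k = 10` and the uniform statement to `k = 10` (`rhat_thin_slice_iff`) are RankLevelSetRuleQStaircaseMapsC (the
witness `rhat_lt_phiK_695_10_688` of the slice `u = 7` at `k = 10` sits in its own module). Axioms: standard.
-/

namespace PercRepro

open Finset

/-- **The slices `u ≤ 10` of the family `k = 8`, exactly**: paid on EVERY cell `(q+8, q)` iff `u ∉ {2, 3, 4, 5}`. -/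
theorem rhat_eight_slice_iff (u : ℕ) (hu10 : u ≤ 10) :
    (∀ q, u ≤ q → phiK (q + 8) q ≤ rhat q 8 (q - u)) ↔ (u ≠ 2 ∧ u ≠ 3 ∧ u ≠ 4 ∧ u ≠ 5) := by
  constructor
  · intro h
    refine ⟨fun hu2 => ?_, fun hu3 => ?_, fun hu4 => ?_, fun hu5 => ?_⟩
    · subst hu2
      have h1 := h (4 ^ (8 + 3) + 2) (by norm_num)
      have h2 := rhat_lt_phiK_of_five_le 8 (by norm_num) (4 ^ (8 + 3)) le_rfl
      rw [show 4 ^ (8 + 3) + 2 - 2 = 4 ^ (8 + 3) by omega] at h1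
      exact absurd (lt_of_lt_of_le h2 h1) (lt_irrefl _)
    · subst hu3
      have h1 := h 129 (by norm_num)
      have h2 := rhat_lt_phiK_129_8_126
      rw [show (129 : ℕ) - 3 = 126 by norm_num] at h1
      exact absurd (lt_of_lt_of_le h2 h1) (lt_irrefl _)
    · subst hu4
      have h1 := h 126 (by norm_num)
      have h2 := rhat_lt_phiK_126_8_122
      rw [show (126 : ℕ) - 4 = 122 by norm_num] at h1
      exact absurd (lt_of_lt_of_le h2 h1) (lt_irrefl _)
    · subst hu5
      have h1 := h 408 (by norm_num)
      have h2 := rhat_lt_phiK_408_8_403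
      rw [show (408 : ℕ) - 5 = 403 by norm_num] at h1
      exact absurd (lt_of_lt_of_le h2 h1) (lt_irrefl _)
  · rintro ⟨hu2, hu3, hu4, hu5⟩ q hq
    rcases Nat.lt_or_ge u 7 with hlt | hge
    · interval_cases u
      · rw [Nat.sub_zero]; exact rhatCell_self q 8 (by norm_num)
      · exact rhatCell_pred q 8 hq (by norm_num)
      · exact absurd rfl hu2
      · exact absurd rfl hu3
      · exact absurd rfl hu4
      · exact absurd rfl hu5
      · exact rhat_eight_slice_six_all q hq
    · exact rhat_staircase_ten 8 u q (by norm_num) (by norm_num) (by omega) hu10 hq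

/-- **The slices `u ≤ 10` of the family `k = 9`, exactly**: paid on EVERY cell `(q+9, q)` iff `u ∉ {2, 3, 4, 5, 6}`. -/
theorem rhat_nine_slice_iff (u : ℕ) (hu10 : u ≤ 10) :
    (∀ q, u ≤ q → phiK (q + 9) q ≤ rhat q 9 (q - u)) ↔ (u ≠ 2 ∧ u ≠ 3 ∧ u ≠ 4 ∧ u ≠ 5 ∧ u ≠ 6) := by
  constructor
  · intro h
    refine ⟨fun hu2 => ?_, fun hu3 => ?_, fun hu4 => ?_, fun hu5 => ?_, fun hu6 => ?_⟩
    · subst hu2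
      have h1 := h (4 ^ (9 + 3) + 2) (by norm_num)
      have h2 := rhat_lt_phiK_of_five_le 9 (by norm_num) (4 ^ (9 + 3)) le_rfl
      rw [show 4 ^ (9 + 3) + 2 - 2 = 4 ^ (9 + 3) by omega] at h1
      exact absurd (lt_of_lt_of_le h2 h1) (lt_irrefl _)
    · subst hu3
      have h1 := h 144 (by norm_num)
      have h2 := rhat_lt_phiK_144_9_141
      rw [show (144 : ℕ) - 3 = 141 by norm_num] at h1
      exact absurd (lt_of_lt_of_le h2 h1) (lt_irrefl _)
    · subst hu4
      have h1 := h 93 (by norm_num)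
      have h2 := rhat_lt_phiK_93_9_89
      rw [show (93 : ℕ) - 4 = 89 by norm_num] at h1
      exact absurd (lt_of_lt_of_le h2 h1) (lt_irrefl _)
    · subst hu5
      have h1 := h 151 (by norm_num)
      have h2 := rhat_lt_phiK_151_9_146
      rw [show (151 : ℕ) - 5 = 146 by norm_num] at h1
      exact absurd (lt_of_lt_of_le h2 h1) (lt_irrefl _)
    · subst hu6
      have h1 := h 541 (by norm_num)
      have h2 := rhat_lt_phiK_541_9_535
      rw [show (541 : ℕ) - 6 = 535 by norm_num] at h1
      exact absurd (lt_of_lt_of_le h2 h1) (lt_irrefl _)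
  · rintro ⟨hu2, hu3, hu4, hu5, hu6⟩ q hq
    rcases Nat.lt_or_ge u 8 with hlt | hge
    · interval_cases u
      · rw [Nat.sub_zero]; exact rhatCell_self q 9 (by norm_num)
      · exact rhatCell_pred q 9 hq (by norm_num)
      · exact absurd rfl hu2
      · exact absurd rfl hu3
      · exact absurd rfl hu4
      · exact absurd rfl hu5
      · exact absurd rfl hu6
      · exact rhat_nine_slice_seven_all q hq
    · exact rhat_staircase_ten 9 u q (by norm_num) (by norm_num) (by omega) hu10 hq

/-- **THE THIN-SLICE MAP OF EVERY FAMILY `k = 5 … 9`, EXACTLY, UP TO `u = 10`**: Rule Q's equal split pays the slice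
`u = q − #P` on EVERY cell `(q+k, q)` if and only if `u ∉ [2, k − 3]` — the slices `u ≤ 1`, the borderline `u = k − 2` and the
untruncated `k − 1 ≤ u ≤ 10` are paid on every cell, the slices `2 ≤ u ≤ k − 3` each fail on some cell. -/
theorem rhat_thin_slice_iff_nine (k u : ℕ) (hk5 : 5 ≤ k) (hk9 : k ≤ 9) (hu10 : u ≤ 10) :
    (∀ q, u ≤ q → phiK (q + k) q ≤ rhat q k (q - u)) ↔ (u < 2 ∨ k - 2 ≤ u) := by
  interval_cases k
  · rw [rhat_five_slice_iff_ten u hu10]; omega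
  · rw [rhat_six_slice_iff_ten u hu10]; omega
  · rw [rhat_seven_slice_iff_ten u hu10]; omega
  · rw [rhat_eight_slice_iff u hu10]; omega
  · rw [rhat_nine_slice_iff u hu10]; omega

end PercRepro
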